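import Summits.BirchSwinnertonDyer.Rank1Residual.ManinAdditive.MinusOneLevelRaisingSixteenSplit
import Summits.BirchSwinnertonDyer.BirchSwinnertonDyer.Theorems.ManinLocalTwoThreeNegOneTwistConductorTwoMul
import HarnessLib

/-!
# S-an-60 node `NegOneTwistConductorTwoMul` DISCHARGED BY NAME; the route crux C2 `ManinOddAtFour` ⟺ `ManinOddAtSixteen`
# (and ⟺ `ManinOddAtEight`) in the kernel with NO print input
# (route `ManinLocalTwoThree`, crux C2 stmt-BirchSwinnertonDyer-22967; cell bsd-f2-manin: an g32 MEMO-an §75.9/§9bis, typer B4 p696338 / B5b p698181,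
# LEAD decision STATUS 2026-08-29T04:58:06Z «TRIGGER: S-an-60 `_holds` ACCEPTED + B5b landed ⇒ re-index 22967 to the single child ManinOddAtSixteen»;
# p2 gen 13)

Both print inputs of an's SPLIT-16 chain `NegOneTwistConductorFourMul → NegOneTwistConductorTwoMul → ManinOddAtSixteen → ManinOddAtFour` are
theorems of this lineage (`negOneTwistConductorFourMul_holds`, p696508; `conductorNorm_quadraticTwist_negOne_eq_two_mul`, p698119 — Barrios et
al. 2025 Thm. 5.1 rows IV/IV*/III/I₁*/III*/II* by Tate's algorithm over `ℤ₂`), so the chain reads without hypotheses: the crux is EQUIVALENT to its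
own restriction to levels `16 ∣ N` (`maninOddAtFour_iff_maninOddAtSixteen`), and to levels `8 ∣ N` (`maninOddAtFour_iff_maninOddAtEight`).

HONEST FRAMING: a re-indexing of the OPEN crux C2, not progress on its `16 ∣ N` stratum; `ManinOddAtSixteen` is open.  BSD is not proved;
Manin's conjecture is not proved; C2/C3 OPEN. [cite: BarriosEtAl2025, Thm. 5.1] [cite: Pal2012, Lemma 3.1 and Prop. 2.4] [cite: Stevens1989, Lemma (5.4) p. 97]
-/

set_option autoImplicit false
-- lint-debt: the directory name repeats the summit name (sibling precedent `ManinLocalTwoThreeNegOneTwistConductorAtTwo.lean`)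
set_option linter.dupNamespace false

noncomputable section

open Summit.BirchSwinnertonDyer.Rank1Residual.ManinAdditive

namespace Summit.BirchSwinnertonDyer.BirchSwinnertonDyer.Theorems.ManinLocalTwoThree

/-- **S-an-60 `NegOneTwistConductorTwoMul` HOLDS** (an g32; typer B5b p698181): `8 ∥ N(W) ⟹ N(W ⊗ (−1)) = 2·N(W)` is a theorem of the tree.
[cite: BarriosEtAl2025, Thm. 5.1, rows III / I₁* / III* / II*] -/
theorem negOneTwistConductorTwoMul_holds : Summit.BirchSwinnertonDyer.Rank1Residual.ManinAdditive.NegOneTwistConductorTwoMul :=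
  fun W _ h8 h16 ↦ conductorNorm_quadraticTwist_negOne_eq_two_mul W h8 h16

/-- **S-an-61 `MinusOneLevelRaisingByTwoOptimalPartner` modulo modularity ONLY** (an's `minusOneLevelRaisingByTwoOptimalPartner_of` with S-an-60
discharged). [cite: Pal2012, Lemma 3.1 and Prop. 2.4] [cite: Stevens1989, Lemma (5.4) p. 97] -/
theorem minusOneLevelRaisingByTwoOptimalPartner_of_modularity
    (hnf : Literature.NumberTheory.EllipticCurves.ModularForms.exists_isNewformOf) :
    Summit.BirchSwinnertonDyer.Rank1Residual.ManinAdditive.MinusOneLevelRaisingByTwoOptimalPartner :=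
  minusOneLevelRaisingByTwoOptimalPartner_of hnf negOneTwistConductorTwoMul_holds

/-- **C2 ⟸ its `16 ∣ N` stratum, print-free**: an's `maninOddAtFour_of_maninOddAtSixteen` with S-an-58 and S-an-60 discharged. -/
theorem maninOddAtFour_of_maninOddAtSixteen' (h16 : ManinOddAtSixteen) :
    Summit.BirchSwinnertonDyer.BirchSwinnertonDyer.Theses.ManinLocalTwoThree.ManinOddAtFour :=
  maninOddAtFour_of_maninOddAtSixteen negOneTwistConductorFourMul_holds negOneTwistConductorTwoMul_holds h16

/-- **THE ROUTE CRUX C2 `ManinOddAtFour` ⟺ `ManinOddAtSixteen`** (the LEAD's re-indexing trigger, STATUS 2026-08-29T04:58:06Z): kernel equivalence,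
no print input, no modularity hypothesis beyond those the two statements already carry. -/
theorem maninOddAtFour_iff_maninOddAtSixteen :
    Summit.BirchSwinnertonDyer.BirchSwinnertonDyer.Theses.ManinLocalTwoThree.ManinOddAtFour ↔ ManinOddAtSixteen :=
  ⟨maninOddAtSixteen_of_maninOddAtFour, maninOddAtFour_of_maninOddAtSixteen'⟩

/-- **C2 ⟺ `ManinOddAtEight`** (an's SPLIT-8, B4, with S-an-58 discharged). -/
theorem maninOddAtFour_iff_maninOddAtEight :
    Summit.BirchSwinnertonDyer.BirchSwinnertonDyer.Theses.ManinLocalTwoThree.ManinOddAtFour ↔ ManinOddAtEight :=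
  ⟨maninOddAtEight_of_maninOddAtFour, maninOddAtFour_of_maninOddAtEight negOneTwistConductorFourMul_holds⟩

/-- **`ManinOddAtEight` ⟺ `ManinOddAtSixteen`** (S-an-60 discharged). -/
theorem maninOddAtEight_iff_maninOddAtSixteen : ManinOddAtEight ↔ ManinOddAtSixteen :=
  ⟨fun h ↦ maninOddAtSixteen_of_maninOddAtFour (maninOddAtFour_of_maninOddAtEight negOneTwistConductorFourMul_holds h),
    maninOddAtEight_of_maninOddAtSixteen negOneTwistConductorTwoMul_holds⟩

end Summit.BirchSwinnertonDyer.BirchSwinnertonDyer.Theorems.ManinLocalTwoThree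

end
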